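import Literature.NumberTheory.EllipticCurves.TateCurve.TorsionGaloisModule
import Literature.NumberTheory.EllipticCurves.OrdinaryReductionTateModuleProofs
import Literature.NumberTheory.EllipticCurves.TateCurve.NumberFieldUniformization
import Literature.NumberTheory.GaloisRepresentations.ModNCyclotomicCharacter
import HarnessLib

/-!
# Crux `GoodLatticeBDPValue` (stmt-BirchSwinnertonDyer-19032), line `halves`, AN-3 Stub B road — brick F2a:
# the TATE BASIS of `E[N] = E(K̄)[N]` at a multiplicative place, from a (split) Tate parametrisation

Width seat bsd-line-x1-p1-w3 (gen 4). HONEST FRAMING (cell `bsd-eis`, run/shared/lean/pub/bsd-eis/):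
TOOL THEOREM ONLY (no `def`, no named fact, no `sorry`); nothing about a summit statement,
Keller–Yin Thm. 2.2.2 or crux 2 is proved here; 0 stubs / cells / labels move.

WHY (road memo `HOME/line-x1-p1-w3-g4/AN3-StubB-elementary-road.md`, evidence #44, §4 F2). Bricks
F1 (`FullDescentTateAlgebra.*`, p652704/p652904) are pure algebra over a "Tate basis" `(P₁, P₂)` of
the `N`-torsion with `σ • P₁ = χ(σ) • P₁`, `σ • P₂ = P₂ + κ(σ) • P₁`. This file PRODUCES that basis in
the GLOBAL module `E(K̄)` (`geomPoints W`) at a finite place `v` of a number field `K`, for the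
decomposition group `Γ_{K_v} → Γ_K` (`absGaloisRestrict`), from an UNTWISTED Tate parametrisation
`Ψ : K̄_v^* → E(K̄_v)` (surjective, kernel `q^ℤ`, `Γ_{K_v}`-equivariant — the split case of the
tree's DISCHARGED `TateCurve.Silverman1994_thmV53_corV54_tateUniformisation_holds`, Silverman
*ATAEC* V.3.1/V.5.3): `P₁ = ι⁻¹Ψ(ζ_N)`, `P₂ = ι⁻¹Ψ(q^{1/N})`, with `χ` THE mod-`N` cyclotomic
character (`modNCyclotomicCharacter K N (res σ)`, as a natural number `< N`). Engine: the tree's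
`TateCurve.exists_basis_of_uniformization` (applied to `M = E(K̄_v)` with the `‖·‖` of
`Valued.toNontriviallyNormedField`), transported to `E(K̄)` along the injective equivariant
`pointsMap` (`Sha.lean`), all `N`-torsion of `E(K̄_v)` being algebraic (`card_torsionBy_eq_sq`,
`exists_mem_torsionBy_eq_of_injective`).

* `exists_tateBasis_geomPoints` — the basis with its six clauses (torsion, generation, relations,
  the two action formulas) for every `N ≥ 1`, from an untwisted parametrisation given as data;
* `exists_tateBasis_geomPoints_of_hasSplitMultiplicativeReductionAt` — UNCONDITIONAL at a place of
  SPLIT multiplicative reduction (`TateCurve.Silverman1994_thmV53_tateUniformisation_holds`).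

References: [SilvermanATAEC1994] Ch. V Thm. 3.1 (c),(d), Lemma 5.2 (c), Thm. 5.3, Cor. 5.4 (PDF
pp. 394–410); [SerreInventiones1972] §1.12.
-/

noncomputable section

open scoped Classical NNReal NumberField AddSubgroup
open NumberField IsDedekindDomain

set_option autoImplicit false
set_option linter.dupNamespace false

namespace Summit.BirchSwinnertonDyer.BirchSwinnertonDyer.Theorems.FullDescentTateBasis

open _root_.WeierstrassCurve Literature.NumberTheory.EllipticCurves Literature.NumberTheory.GaloisRepresentations
  Field IsDedekindDomain.HeightOneSpectrum Literature.NumberTheory.EllipticCurves.TateCurve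

/-- **The Tate basis of `E(K̄)[N]` at a place with an untwisted Tate parametrisation** (Silverman
*ATAEC* V §3 / proof of V.5.2: `0 → μ_N → E_q[N] → ℤ/N → 0`, extension class = the Kummer class of
`q`). For `Ψ : K̄_v^* → E(K̄_v)` surjective with kernel `q^ℤ` (`0 < |q|_v < 1`) and
`Γ_{K_v}`-equivariant, and `N ≥ 1`: there are `P₁, P₂ ∈ E(K̄)` killed by `N`, generating the
`N`-torsion with relations exactly `N ∣ a ∧ N ∣ b`, on which `τ ∈ Γ_{K_v}` acts by
`res τ • P₁ = χ_N(res τ) • P₁` and `res τ • P₂ = P₂ + κ(τ) • P₁` (`χ_N` the mod-`N` cyclotomic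
character as a natural number, `κ(τ)` defined by `τ(q^{1/N}) = ζ_N^{κ(τ)} q^{1/N}`).
[cite: SilvermanATAEC1994, Thm. V.3.1 (c),(d), Lemma V.5.2 (PDF pp. 395–399, 406)] -/
theorem exists_tateBasis_geomPoints {K : Type} [Field K] [NumberField K]
    (W : WeierstrassCurve K) [W.IsElliptic] (v : HeightOneSpectrum (𝓞 K))
    {q : v.adicCompletion K} (hq0 : q ≠ 0) (hq1 : Valued.v q < 1)
    {Ψ : Additive (AlgebraicClosure (v.adicCompletion K))ˣ →+ localPoints W (v.adicCompletion K)}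
    (hsurj : Function.Surjective Ψ)
    (hker : ∀ u : (AlgebraicClosure (v.adicCompletion K))ˣ, Ψ (Additive.ofMul u) = 0 ↔
      ∃ n : ℤ, (u : AlgebraicClosure (v.adicCompletion K)) =
        algebraMap (v.adicCompletion K) (AlgebraicClosure (v.adicCompletion K)) q ^ n)
    (hequiv : ∀ (σ : absoluteGaloisGroup (v.adicCompletion K))
      (u : (AlgebraicClosure (v.adicCompletion K))ˣ),
      σ • Ψ (Additive.ofMul u) = Ψ (Additive.ofMul (Units.map
        (absoluteGaloisGroup.toAlgEquiv (v.adicCompletion K) σ :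
          AlgebraicClosure (v.adicCompletion K) →* AlgebraicClosure (v.adicCompletion K)) u)))
    {N : ℕ} [NeZero N] :
    ∃ (P₁ P₂ : geomPoints W) (κ : absoluteGaloisGroup (v.adicCompletion K) → ℕ),
      ((N : ℕ) : ℤ) • P₁ = 0 ∧ ((N : ℕ) : ℤ) • P₂ = 0 ∧
      (∀ P : geomPoints W, ((N : ℕ) : ℤ) • P = 0 → ∃ a b : ℤ, P = a • P₁ + b • P₂) ∧
      (∀ a b : ℤ, a • P₁ + b • P₂ = 0 ↔ ((N : ℕ) : ℤ) ∣ a ∧ ((N : ℕ) : ℤ) ∣ b) ∧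
      (∀ τ : absoluteGaloisGroup (v.adicCompletion K),
        absGaloisRestrict K (v.adicCompletion K) τ • P₁ =
          ((modNCyclotomicCharacter K N (absGaloisRestrict K (v.adicCompletion K) τ) : ZMod N)).val • P₁) ∧
      (∀ τ : absoluteGaloisGroup (v.adicCompletion K),
        absGaloisRestrict K (v.adicCompletion K) τ • P₂ = P₂ + κ τ • P₁) := by
  have hN : 0 < N := Nat.pos_of_ne_zero (NeZero.ne N)
  haveI : CharZero (AlgebraicClosure (v.adicCompletion K)) :=
    charZero_of_injective_algebraMap (algebraMap K (AlgebraicClosure (v.adicCompletion K))).injective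
  -- the norm on `K_v` (for the engine's `‖q‖ < 1`)
  have hq : (letI := Valued.toNontriviallyNormedField (v.adicCompletion K) (WithZero (Multiplicative ℤ));
      ‖q‖ < 1) := by
    letI := Valued.toNontriviallyNormedField (v.adicCompletion K) (WithZero (Multiplicative ℤ))
    exact Valued.toNormedField.norm_lt_one_iff.mpr hq1
  -- roots: a global primitive `N`-th root of unity `ζ`, its image `ζ' = ι ζ`, and `Q = q^{1/N}`
  set ι := closureEmb (K := K) (v.adicCompletion K) with hι
  obtain ⟨ζ, hζ⟩ := HasEnoughRootsOfUnity.exists_primitiveRoot (AlgebraicClosure K) N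
  set ζ' : AlgebraicClosure (v.adicCompletion K) := ι ζ with hζ'def
  have hζ' : IsPrimitiveRoot ζ' N := hζ.map_of_injective ι.injective
  obtain ⟨Q, hQ⟩ := IsAlgClosed.exists_pow_nat_eq
    (algebraMap (v.adicCompletion K) (AlgebraicClosure (v.adicCompletion K)) q) hN
  -- the engine
  obtain ⟨P₁', P₂', h1', h2', hgen', hrel', hact1', hact2'⟩ := by
    letI := Valued.toNontriviallyNormedField (v.adicCompletion K) (WithZero (Multiplicative ℤ))
    exact exists_basis_of_uniformization (M := localPoints W (v.adicCompletion K)) hq0 hq hsurj hker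
      hequiv hN hζ' hQ
  -- transport to `E(K̄)`: all `N`-torsion of `E(K̄_v)` is algebraic
  set pm := pointsMap W (v.adicCompletion K) with hpm
  have hpm_inj : Function.Injective pm :=
    pointsMapOfEmb_injective W (closureEmb (K := K) (v.adicCompletion K))
  have hA : Nat.card (geomTorsion W ((N : ℕ) : ℤ)) = N ^ 2 :=
    card_torsionBy_eq_sq (E := W.baseChange (AlgebraicClosure K)) (n := N) (by exact_mod_cast NeZero.ne N)
  have hcardL : Nat.card ((localPoints W (v.adicCompletion K))[((N : ℕ) : ℤ)]) = N ^ 2 :=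
    card_torsionBy_eq_sq (E := W.baseChange (AlgebraicClosure (v.adicCompletion K))) (n := N)
      (by exact_mod_cast NeZero.ne N)
  haveI : Finite ((localPoints W (v.adicCompletion K))[((N : ℕ) : ℤ)]) :=
    Nat.finite_of_card_ne_zero (by rw [hcardL]; exact pow_ne_zero 2 (NeZero.ne N))
  have hsurjL : ∀ R ∈ (localPoints W (v.adicCompletion K))[((N : ℕ) : ℤ)],
      ∃ x ∈ geomTorsion W ((N : ℕ) : ℤ), pm x = R := fun R hR ↦
    exists_mem_torsionBy_eq_of_injective pm hpm_inj N (le_of_eq (by rw [hcardL, hA])) R hR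
  obtain ⟨P₁, hP₁t, hP₁⟩ := hsurjL P₁' (by rw [mem_torsionBy_iff]; exact h1')
  obtain ⟨P₂, hP₂t, hP₂⟩ := hsurjL P₂' (by rw [mem_torsionBy_iff]; exact h2')
  -- `κ`: `τ Q = ζ'^{κ τ} Q`
  have hκex : ∀ τ : absoluteGaloisGroup (v.adicCompletion K), ∃ d : ℕ, τ • Q = ζ' ^ d * Q := by
    intro τ
    have hQ0 : Q ≠ 0 := by
      intro h0
      rw [h0, zero_pow hN.ne'] at hQ
      exact hq0 ((map_eq_zero_iff _ (algebraMap (v.adicCompletion K) _).injective).mp hQ.symm)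
    have hτQN : (τ • Q) ^ N = algebraMap (v.adicCompletion K) (AlgebraicClosure (v.adicCompletion K)) q := by
      change ((absoluteGaloisGroup.toAlgEquiv (v.adicCompletion K) τ) Q) ^ N = _
      rw [← map_pow, hQ, AlgEquiv.commutes]
    have hpow : (τ • Q * Q⁻¹) ^ N = 1 := by
      rw [mul_pow, inv_pow, hτQN, ← hQ, mul_inv_cancel₀ (pow_ne_zero N hQ0)]
    obtain ⟨d, -, hd⟩ := hζ'.eq_pow_of_pow_eq_one hpow
    exact ⟨d, by rw [hd, inv_mul_cancel_right₀ hQ0]⟩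
  choose κ hκ using hκex
  -- the cyclotomic exponent of `res τ`
  have hχ : ∀ τ : absoluteGaloisGroup (v.adicCompletion K),
      τ • ζ' = ζ' ^ ((modNCyclotomicCharacter K N (absGaloisRestrict K (v.adicCompletion K) τ) :
        ZMod N)).val := by
    intro τ
    have h := modNCyclotomicCharacter_spec K N (absGaloisRestrict K (v.adicCompletion K) τ) ζ
      hζ.pow_eq_one
    have h' := apply_resGalAuxOfEmb_apply ι τ ζ
    change ι (absGaloisRestrict K (v.adicCompletion K) τ • ζ) = τ • ζ' at h'
    rw [← h', h, map_pow]
  refine ⟨P₁, P₂, κ, mem_torsionBy_iff.mp hP₁t, mem_torsionBy_iff.mp hP₂t, ?_, ?_, ?_, ?_⟩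
  · -- generation
    intro P hP
    have hPL : pm P ∈ (localPoints W (v.adicCompletion K))[((N : ℕ) : ℤ)] := by
      rw [mem_torsionBy_iff, ← map_zsmul, hP, map_zero]
    obtain ⟨a, b, hab⟩ := hgen' (pm P) (mem_torsionBy_iff.mp hPL)
    refine ⟨a, b, hpm_inj ?_⟩
    rw [hab, map_add, map_zsmul, map_zsmul, hP₁, hP₂]
  · -- relations
    intro a b
    rw [← hrel' a b, ← hP₁, ← hP₂, ← map_zsmul, ← map_zsmul, ← map_add]
    exact ⟨fun h ↦ by rw [h, map_zero], fun h ↦ hpm_inj (by rw [h, map_zero])⟩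
  · -- action on `P₁`
    intro τ
    apply hpm_inj
    rw [← resGal_eq_absGaloisRestrict, pointsMap_smul, resGal_eq_absGaloisRestrict, map_nsmul, hP₁]
    exact hact1' τ _ (by simpa [Algebra.smul_def] using hχ τ)
  · -- action on `P₂`
    intro τ
    apply hpm_inj
    rw [← resGal_eq_absGaloisRestrict, pointsMap_smul, map_add, map_nsmul, hP₁, hP₂]
    exact hact2' τ _ (by simpa [Algebra.smul_def] using hκ τ)

/-- **The Tate basis of `E(K̄)[N]` at a place of SPLIT multiplicative reduction — UNCONDITIONAL**:
`exists_tateBasis_geomPoints` fed with the tree's DISCHARGED Tate uniformisation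
`TateCurve.Silverman1994_thmV53_tateUniformisation_holds` (Silverman *ATAEC* V.3.1 (c),(d) + V.5.3
(a),(b): at a split multiplicative place the parametrisation `Φ : K̄_v^* → E(K̄_v)` is surjective with
kernel `q^ℤ` and `Γ_{K_v}`-equivariant). [cite: SilvermanATAEC1994, Ch. V Thm. 3.1 (c),(d), Thm. 5.3 (a),(b)] -/
theorem exists_tateBasis_geomPoints_of_hasSplitMultiplicativeReductionAt {K : Type} [Field K] [NumberField K]
    (W : WeierstrassCurve K) [W.IsElliptic] (v : HeightOneSpectrum (𝓞 K))
    (hsplit : W.HasSplitMultiplicativeReductionAt v) {N : ℕ} [NeZero N] :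
    ∃ (P₁ P₂ : geomPoints W) (κ : absoluteGaloisGroup (v.adicCompletion K) → ℕ),
      ((N : ℕ) : ℤ) • P₁ = 0 ∧ ((N : ℕ) : ℤ) • P₂ = 0 ∧
      (∀ P : geomPoints W, ((N : ℕ) : ℤ) • P = 0 → ∃ a b : ℤ, P = a • P₁ + b • P₂) ∧
      (∀ a b : ℤ, a • P₁ + b • P₂ = 0 ↔ ((N : ℕ) : ℤ) ∣ a ∧ ((N : ℕ) : ℤ) ∣ b) ∧
      (∀ τ : absoluteGaloisGroup (v.adicCompletion K),
        absGaloisRestrict K (v.adicCompletion K) τ • P₁ =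
          ((modNCyclotomicCharacter K N (absGaloisRestrict K (v.adicCompletion K) τ) : ZMod N)).val • P₁) ∧
      (∀ τ : absoluteGaloisGroup (v.adicCompletion K),
        absGaloisRestrict K (v.adicCompletion K) τ • P₂ = P₂ + κ τ • P₁) := by
  obtain ⟨q, Φ, hq0, hq1, hsurj, hker, hΦσ, -⟩ :=
    TateCurve.Silverman1994_thmV53_tateUniformisation_holds W v hsplit
  exact exists_tateBasis_geomPoints W v hq0 hq1 hsurj hker hΦσ

end Summit.BirchSwinnertonDyer.BirchSwinnertonDyer.Theorems.FullDescentTateBasis
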